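import Mathlib.Analysis.Calculus.TangentCone.Real
import Literature.Analysis.FluidPDE.ClassicalSolution
import Literature.Analysis.FluidPDE.LerayHopf
import Literature.Analysis.FluidPDE.NSVorticity
import Literature.Analysis.FluidPDE.NSWave0
import HarnessLib

/-!
# Tao (2011/2013), *Localisation and compactness properties of the Navier–Stokes global
# regularity problem* — vendored facts (family `ns`, topic `Literature/Analysis/FluidPDE`)

Named facts (D-0014: `def … : Prop`, no `sorry`) from

* T. Tao, *Localisation and compactness properties of the Navier–Stokes global regularity
  problem*, Anal. PDE 6 (2013), 25–107; arXiv:1108.1165 (`Tao2011`).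

Physical space is `ℝ³ = EuclideanSpace ℝ (Fin 3)`, velocities `u : ℝ → ℝ³ → ℝ³` (time first),
pressures `p : ℝ → ℝ³ → ℝ`; classical solutions are the accepted
`Literature.Fluid.IsClassicalNSSolutionOn S ν f u p`, and `u ∈ L^∞(S; H^k)` for all `k` is the accepted
`Literature.NS.HasBoundedSobolevNormsOn S u` (`NSVorticity`).

## Dictionary with Tao's categories (Tao2011, §1, pp. 2–3 and 8)

* Tao's *smooth solution* `(u, p, u₀, f, T)` on the **closed** slab `[0, T] × ℝ³`: `u`, `p` smooth
  on `[0, T] × ℝ³`, NS (3) with `ν = 1`, `∇·u = 0` (4), `u(0) = u₀` (5). We use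
  `Fluid.IsClassicalNSSolutionOn (Icc 0 T) ν f u p` (joint `C^∞` on `Icc 0 T ×ˢ univ`, one-sided
  time derivative within `Icc 0 T`), which is Tao's smoothness; Tao's weaker *almost smooth*
  class (p. 8: smooth on `(0, T] × ℝ³`, all `∇ᵏu, ∂ₜ∇ᵏu, ∇ᵏp` continuous up to `t = 0`) contains
  it, so every fact below is stated for a **sub**class of Tao's hypothesis (never stronger than
  the source).
* *finite energy solution* (Tao2011, (6), p. 3): `‖u‖_{L^∞_t L²_x([0,T] × ℝ³)} < ∞`; for a
  velocity continuous on the closed slab the essential and the pointwise supremum in `t` agree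
  (Fatou), so we write `∃ C, ∀ t ∈ Icc 0 T, ∫⁻ ‖u t x‖ₑ² ≤ C`.
* *Schwartz data* (p. 2): `u₀` smooth with all derivatives rapidly decreasing — for the smooth
  slice `u 0` of a classical solution this is the accepted `NS.HasRapidSpatialDecay (u 0)`
  (Fefferman's (4)); *homogeneous* means `f = 0`.
* Viscosity: Tao normalises `ν = 1` (footnote 3, p. 4: "one can easily reduce to the `ν = 1` case
  by a simple rescaling", namely `v(s, x) = ν⁻¹ u(s/ν, x)`, `q(s, x) = ν⁻² p(s/ν, x)`, which maps
  the classes above to themselves and `[0, T]` to `[0, νT]`); the facts are stated for `ν > 0`.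

## Contents

* `NS.tao2011_hasBoundedSobolevNormsOn` — Cor. 11.1 (bounded enstrophy, p. 68) + Cor. 4.3
  (almost smooth `H¹` solutions are essentially mild, p. 28) + Thm. 5.4 (iv) (regularity of `H¹`
  mild solutions from Schwartz data, p. 34, with the parenthetical note that `u₀ ∈ H^k_x` for all
  `k` and `f = 0` suffice): a finite-energy classical solution on the closed slab `[0, T] × ℝ³`
  with `f = 0` and Schwartz datum lies in `L^∞_t H^k_x([0, T] × ℝ³)` for every `k`.
* `NS.linfty_bound_of_hasBoundedSobolevNormsOn` — the Sobolev imbedding `W^{2,2}(ℝ³) → C_B(ℝ³)`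
  (`mp = 4 > 3 = n`; Adams–Fournier, Sobolev imbedding theorem, Part I, case `mp > n`), in the
  form consumed here: `C²` slices with `L²` norms of `u, Du, D²u` bounded uniformly in `t ∈ S` are
  bounded uniformly on `S × ℝ³`.
* `NS.tao2011_hasBoundedSobolevNormsOn.closedSlab` — **proved corollary** (shape of `wi-04767`):
  on the closed slab, finite energy + rapidly decreasing datum ⇒
  `HasBoundedSobolevNormsOn (Icc 0 T) u ∧ MemLqLp ⊤ ⊤ u (Ioo 0 T)`.
* `NS.tao2011_hasBoundedSobolevNormsOn.memLqLp_top` — **proved corollary** in the shape wanted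
  by `stmt-NavierStokesRegularity-0723`: a classical solution on `[0, T)` which is Leray–Hopf from
  a rapidly decaying datum is in `L^∞_t L^∞_x` on `(0, T')` for every `T' < T` (finite energy on
  `[0, T']` comes from the Leray–Hopf energy inequality with `f = 0`).

## Mathlib / tree search

Mathlib (this pin) has no Navier–Stokes material (`lean search NavierStokes|Leray|enstrophy`:
tree hits only). Tree: no `Tao2011` decl before this file; `HasBoundedSobolevNormsOn`,
`IsClassicalNSSolutionOn`, `IsLerayHopfOn`, `MemLqLp`, `HasRapidSpatialDecay` are reused, nothing
is redefined.

## References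

* T. Tao, arXiv:1108.1165 = Anal. PDE 6 (2013): §1 (pp. 2–8, classes of data and solutions,
  (6), (9)), Lemma 4.1 and Cor. 4.3 (pp. 24–28), Thm. 5.4 (pp. 33–34), Lemma 8.1 (p. 43),
  Cor. 11.1, Remark 11.3, Cor. 11.4 (pp. 68–69).
* R. A. Adams, J. J. F. Fournier, *Sobolev Spaces*, 2nd ed. (2003), Thm. 4.12 (Sobolev imbedding
  theorem), Part I Case A (`mp > n`: `W^{j+m,p}(Ω) → C_B^j(Ω)`); 1st ed. (1975) Thm. 5.4 Case C.
-/

noncomputable section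

open MeasureTheory Set Function Filter Topology
open scoped ENNReal NNReal InnerProductSpace RealInnerProductSpace ContDiff

namespace Literature.Analysis.FluidPDE

/-- Local notation for physical space `ℝ³ = EuclideanSpace ℝ (Fin 3)`. -/
local notation "ℝ³" => EuclideanSpace ℝ (Fin 3)

/-! ## Regularity persistence for finite-energy smooth solutions (Tao2011, Cor. 11.1 + Cor. 4.3 + Thm. 5.4) -/

/-- **Tao 2011, Cor. 11.1 + Cor. 4.3 + Thm. 5.4 (iv)** (homogeneous case `f = 0`, viscosity
`ν > 0` by the rescaling of footnote 3). Let `(u, p)` be a classical solution of Navier–Stokes on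
the **closed** slab `[0, T] × ℝ³`, `T > 0` (jointly smooth up to and including `t = T`; in
particular an *almost smooth* solution in Tao's sense, p. 8), of *finite energy*
`sup_{t ∈ [0,T]} ∫ |u(t)|² < ∞` (Tao2011, (6)), whose datum `u(0)` is Schwartz
(`HasRapidSpatialDecay (u 0)`, all derivatives rapidly decreasing). Then
`u ∈ L^∞_t H^k_x([0, T] × ℝ³)` for every `k`, i.e. `HasBoundedSobolevNormsOn (Icc 0 T) u`.
Chain in print: the datum has finite `H¹` norm, so by Cor. 11.1 (bounded enstrophy, p. 68)
`u ∈ X¹([0,T] × ℝ³)` and `(u, p, u₀, 0, T)` is an `H¹` solution; by Cor. 4.3 (p. 28) `(u, p̃)` with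
the normalised pressure `p̃ = -Δ⁻¹∂ᵢ∂ⱼ(uᵢuⱼ)` is an `H¹` mild solution (same velocity `u`); by
Thm. 5.4 (iv) (p. 34) and the note closing its proof ("it would have sufficed to have
`u₀ ∈ H^k_x(ℝ³)` and `f ∈ C^j_t H^k_x` for all `j, k`") one has `∂ₜʲ u ∈ L^∞_t H^k_x([0,T] × ℝ³)`
for all `j, k ≥ 0`; the case `j = 0` is the conclusion (for the smooth slices `u t` the `H^k`
norm is the sum of the `L²` norms of `D^i (u t)`, `i ≤ k`). As Tao stresses (Remark 11.2), the
closedness of the slab is essential: nothing is claimed for solutions smooth only on `[0, T)`. [cite: Tao2011, Cor. 11.1 + Cor. 4.3 + Thm. 5.4 (iv)] -/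
def tao2011_hasBoundedSobolevNormsOn : Prop :=
  ∀ ⦃ν T : ℝ⦄ (_hν : 0 < ν) (_hT : 0 < T) ⦃u : ℝ → ℝ³ → ℝ³⦄ ⦃p : ℝ → ℝ³ → ℝ⦄
    (_hsol : FluidPDE.IsClassicalNSSolutionOn (Icc 0 T) ν 0 u p)
    (_hE : ∃ C : ℝ≥0, ∀ t ∈ Icc 0 T, ∫⁻ x, ‖u t x‖ₑ ^ 2 ≤ C)
    (_h₀ : HasRapidSpatialDecay (u 0)),
    HasBoundedSobolevNormsOn (Icc 0 T) u

/-- **Sobolev imbedding `W^{2,2}(ℝ³) → C_B(ℝ³)`** (Adams–Fournier, *Sobolev Spaces*, Sobolev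
imbedding theorem Thm. 4.12, Part I Case A, `mp > n` with `m = p = 2`, `n = 3`, `j = 0`, `Ω = ℝⁿ`;
1st ed. Thm. 5.4 Case C): there is a constant `K` with `sup |g| ≤ K ‖g‖_{W^{2,2}(ℝ³)}` for
`g ∈ W^{2,2}(ℝ³)` (for continuous `g` the bounded representative is `g` itself). Stated in the form
used with `HasBoundedSobolevNormsOn`: if every slice `u t`, `t ∈ S`, is `C²` (so that
`iteratedFDeriv ℝ n (u t)`, `n ≤ 2`, are the classical derivatives, no junk) and the `L²(ℝ³)`
norms of `Dⁿ(u t)` are bounded uniformly in `t ∈ S` for every `n` (only `n ≤ 2` is used), then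
`u` is bounded on `S × ℝ³`. [cite: AdamsFournier2003, Thm. 4.12 Part I Case A (mp > n)] -/
def linfty_bound_of_hasBoundedSobolevNormsOn : Prop :=
  ∀ ⦃S : Set ℝ⦄ ⦃u : ℝ → ℝ³ → ℝ³⦄ (_hu : ∀ t ∈ S, ContDiff ℝ 2 (u t))
    (_hH : HasBoundedSobolevNormsOn S u),
    ∃ C : ℝ, ∀ t ∈ S, ∀ x, ‖u t x‖ ≤ C

/-! ## Proved corollary: the `L^∞_{t,x}` bound on compact sub-strips (shape of `stmt-…-0723`) -/

/-- For a Leray–Hopf solution with `f = 0` and `ν ≥ 0` the energy is bounded by the initial energy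
on `[0, T]`: `∫⁻ ‖u t‖ₑ² ≤ ofReal (2 E(u₀))` (energy inequality from `s = 0`, field
`weakGrad_energy`, dropping the dissipation; Leray 1934, (5.2)). [cite: Leray1934, (5.2)] -/
theorem IsLerayHopfOn.lintegral_enorm_sq_le
    {E : Type*} [NormedAddCommGroup E] [InnerProductSpace ℝ E] [FiniteDimensional ℝ E]
    [MeasurableSpace E] [BorelSpace E] {T ν : ℝ} (hν : 0 ≤ ν) {u₀ : E → E} {u : ℝ → E → E}
    (h : FluidPDE.IsLerayHopfOn T ν 0 u₀ u) {t : ℝ} (ht : t ∈ Icc 0 T) :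
    ∫⁻ x, ‖u t x‖ₑ ^ 2 ≤ ENNReal.ofReal (2 * VectorCalculus.kineticEnergy u₀) := by
  obtain ⟨G, -, -, h0, -⟩ := h.weakGrad_energy
  have hle := h0 t ht
  simp only [Pi.zero_apply, inner_zero_left, integral_zero, intervalIntegral.integral_zero,
    add_zero] at hle
  have hkin : VectorCalculus.kineticEnergy (u t) ≤ VectorCalculus.kineticEnergy u₀ :=
    le_trans (le_add_of_nonneg_right (mul_nonneg hν ENNReal.toReal_nonneg)) hle
  have heq := FluidPDE.eEnergy_eq_ofReal (u t) (h.memLp t ht)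
  rw [FluidPDE.eEnergy] at heq
  rw [heq]
  exact ENNReal.ofReal_le_ofReal (by linarith)

/-- **Corollary on the closed slab** (the shape wanted by `wi-04767`, consumers
`stmt-NavierStokesRegularity-0723`, `-0094`), proved from the two named facts above: for `ν > 0`,
`T > 0` and a classical unforced solution `(u, p)` on the **closed** slab `[0, T] × ℝ³` of finite
energy (`sup_{t ∈ [0,T]} ∫ |u t|² < ∞`, here with an `ℝ≥0∞` bound `C < ⊤`) and rapidly decreasing
datum `u 0`, all Sobolev norms of `u` are bounded on `[0, T]` **and** `u ∈ L^∞((0, T); L^∞(ℝ³))`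
(Tao2011, Cor. 11.1 + Cor. 4.3 + Thm. 5.4 (iv); Sobolev imbedding `H² ⊂ L^∞`, Adams–Fournier
Thm. 4.12). Closedness of the slab is essential (Tao2011, Remark 11.2). [cite: Tao2011, Cor. 11.1 + Cor. 4.3 + Thm. 5.4 (iv)] -/
theorem tao2011_hasBoundedSobolevNormsOn.closedSlab (h₁ : tao2011_hasBoundedSobolevNormsOn)
    (h₂ : linfty_bound_of_hasBoundedSobolevNormsOn) (ν T : ℝ) (hν : 0 < ν) (hT : 0 < T)
    (u : ℝ → ℝ³ → ℝ³) (p : ℝ → ℝ³ → ℝ) (hsol : FluidPDE.IsClassicalNSSolutionOn (Icc 0 T) ν 0 u p)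
    (hE : ∃ C : ℝ≥0∞, C < ⊤ ∧ ∀ t ∈ Icc 0 T, ∫⁻ x, ‖u t x‖ₑ ^ 2 ≤ C)
    (h₀ : HasRapidSpatialDecay (u 0)) :
    HasBoundedSobolevNormsOn (Icc 0 T) u ∧ FluidPDE.MemLqLp ⊤ ⊤ u (Ioo 0 T) := by
  -- the energy bound with an `ℝ≥0` constant
  have hE' : ∃ C : ℝ≥0, ∀ t ∈ Icc 0 T, ∫⁻ x, ‖u t x‖ₑ ^ 2 ≤ C := by
    obtain ⟨C, hC, hb⟩ := hE
    exact ⟨C.toNNReal, fun t ht => (hb t ht).trans_eq (ENNReal.coe_toNNReal hC.ne).symm⟩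
  -- Tao: all Sobolev norms bounded on `[0, T]`; Sobolev imbedding: uniform bound
  have hH : HasBoundedSobolevNormsOn (Icc 0 T) u := h₁ hν hT hsol hE' h₀
  have hC2 : ∀ t ∈ Icc 0 T, ContDiff ℝ 2 (u t) := fun t ht =>
    (hsol.contDiff_velocity ht).of_le (by norm_cast)
  obtain ⟨C, hC⟩ := h₂ hC2 hH
  refine ⟨hH, ?_⟩
  -- `MemLqLp ⊤ ⊤ u (Ioo 0 T)`
  have hIoo : Ioo 0 T ⊆ Icc 0 T := Ioo_subset_Icc_self
  have hslice : ∀ t ∈ Ioo 0 T, eLpNorm (u t) ⊤ volume ≤ ENNReal.ofReal C := fun t ht => by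
    rw [eLpNorm_exponent_top]
    exact eLpNormEssSup_le_of_ae_bound (Eventually.of_forall (hC t (hIoo ht)))
  have hC0 : 0 ≤ C := by
    obtain ⟨t, ht⟩ : (Ioo 0 T).Nonempty := nonempty_Ioo.2 hT
    exact (norm_nonneg _).trans (hC t (hIoo ht) 0)
  refine ⟨?_, ?_⟩
  · refine (ae_restrict_iff' measurableSet_Ioo).2 (Eventually.of_forall fun t ht => ?_)
    exact memLp_top_of_bound
      ((hsol.contDiff_velocity (hIoo ht)).continuous.aestronglyMeasurable) C
      (Eventually.of_forall (hC t (hIoo ht)))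
  · rw [FluidPDE.eLqLpNorm, eLpNorm_exponent_top]
    refine eLpNormEssSup_lt_top_of_ae_bound (C := C) ?_
    refine (ae_restrict_iff' measurableSet_Ioo).2 (Eventually.of_forall fun t ht => ?_)
    rw [Real.norm_of_nonneg ENNReal.toReal_nonneg]
    exact ENNReal.toReal_le_of_le_ofReal hC0 (hslice t ht)

/-- **Corollary on compact sub-strips** (the signature of `stmt-NavierStokesRegularity-0723`,
verbatim), proved from the two named facts above: let `ν > 0`, `T > 0`, `(u, p)` a classical
unforced solution on `[0, T) × ℝ³` which is a Leray–Hopf solution on `[0, T)` from its own datum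
`u 0`, the datum being rapidly decreasing. Then `u ∈ L^∞((0, T'); L^∞(ℝ³))` for every
`0 < T' < T`. Proof: restrict to the closed slab `[0, T']` (`IsClassicalNSSolutionOn.mono`), where
the energy is bounded by the Leray–Hopf energy inequality (`IsLerayHopfOn.lintegral_enorm_sq_le`),
and apply `tao2011_hasBoundedSobolevNormsOn.closedSlab`
(Tao2011, Cor. 11.1 + Cor. 4.3 + Thm. 5.4; Adams–Fournier Thm. 4.12). [cite: Tao2011, Cor. 11.1 + Cor. 4.3 + Thm. 5.4 (iv)] -/
theorem tao2011_hasBoundedSobolevNormsOn.memLqLp_top (h₁ : tao2011_hasBoundedSobolevNormsOn)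
    (h₂ : linfty_bound_of_hasBoundedSobolevNormsOn) (ν T : ℝ) (hν : 0 < ν) (_hT : 0 < T)
    (u : ℝ → ℝ³ → ℝ³) (p : ℝ → ℝ³ → ℝ) (hsol : FluidPDE.IsClassicalNSSolutionOn (Ico 0 T) ν 0 u p)
    (hLH : FluidPDE.IsLerayHopfOn T ν 0 (u 0) u) (h₀ : HasRapidSpatialDecay (u 0)) :
    ∀ T' ∈ Ioo 0 T, FluidPDE.MemLqLp ⊤ ⊤ u (Ioo 0 T') := by
  intro T' hT'
  -- restrict to the closed slab `[0, T']`
  have hsol' : FluidPDE.IsClassicalNSSolutionOn (Icc 0 T') ν 0 u p :=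
    hsol.mono (Icc_subset_Ico_right hT'.2) (uniqueDiffOn_Icc hT'.1)
  -- finite energy on `[0, T']` from the Leray–Hopf energy inequality
  have hE : ∃ C : ℝ≥0∞, C < ⊤ ∧ ∀ t ∈ Icc 0 T', ∫⁻ x, ‖u t x‖ₑ ^ 2 ≤ C :=
    ⟨ENNReal.ofReal (2 * VectorCalculus.kineticEnergy (u 0)), ENNReal.ofReal_lt_top, fun t ht =>
      hLH.lintegral_enorm_sq_le hν.le ⟨ht.1, ht.2.trans hT'.2.le⟩⟩
  exact (tao2011_hasBoundedSobolevNormsOn.closedSlab h₁ h₂ ν T' hν hT'.1 u p hsol' hE h₀).2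

/-! ## Decomposition of `tao2011_hasBoundedSobolevNormsOn` along the printed chain

`tao2011_hasBoundedSobolevNormsOn` is the composite of two results of Tao2011 whose proofs are
disjoint theories: **Cor. 11.1** (bounded enstrophy; it rests on the enstrophy localisation
Thm. 10.1, the local energy inequality Thm. 8.2, the bounded total speed Prop. 9.1 and the
global energy inequality Lemma 8.1 = `NS.tao_finite_energy_smooth_energy_bound`) and
**Cor. 4.3 + Thm. 5.4 (iv)** (an almost smooth `H¹` solution is, after normalising the pressure,
an `H¹` mild solution, and `H¹` mild solutions propagate `H^k` regularity of the datum). The two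
are vendored separately below (`tao2011_boundedEnstrophy`,
`tao2011_hasBoundedSobolevNormsOn_of_memSobolevX`), the hinge being Tao's class
`X¹([0, T] × ℝ³)` (`MemSobolevX 1 T u`), and the composite is **proved** from them
(`tao2011_hasBoundedSobolevNormsOn_of_parts`), the only extra ingredient being that a Schwartz
datum has all derivatives in `L²` (`HasRapidSpatialDecay.lintegral_enorm_iteratedFDeriv_sq_lt_top`,
proved). -/

/-- Tao's hybrid class `X^k([0, T] × ℝ³) = L^∞_t H^k_x ∩ L²_t H^{k+1}_x` (Tao2011, §2, display
(x-def): `X^s(I × Ω) := L^∞_t H^s_x(I × Ω) ∩ L²_t H^{s+1}_x(I × Ω)`, with the classical Sobolev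
norm `‖v‖_{H^k_x} = (∑_{j ≤ k} ‖∇ʲv‖²_{L²})^{1/2}` of a smooth `v`), for a velocity field
`u : ℝ → ℝ³ → ℝ³` with smooth slices, in the elementary form of `HasBoundedSobolevNormsOn`: the
`L²(ℝ³)` norms of `Dʲ(u t)`, `j ≤ k`, are bounded uniformly in `t ∈ [0, T]`, and
`∫₀ᵀ ∫ ‖D^{k+1}(u t)‖² dt < ∞` (the terms `j ≤ k` of the `L²_t H^{k+1}_x` norm are then finite on
the bounded time interval, so only the top one is recorded). As in `HasBoundedSobolevNormsOn`:
pointwise rather than essential supremum in `t` (for a field jointly smooth on the closed slab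
`t ↦ ∫ ‖Dʲu(t)‖²` is lower semicontinuous by Fatou, so the two agree), lower Lebesgue integrals
(no measurability side condition), and operator norms of the Fréchet derivatives in place of the
Euclidean tensor norms `|∇ʲu|` (equivalent up to dimensional constants, so membership is
unchanged). `k = 0` is the energy class `X⁰`; `k = 1` is bounded enstrophy, the solution part of
Tao's *`H¹` solution* ((7), p. 3: `‖u‖_{L^∞_t H¹_x} + ‖u‖_{L²_t H²_x} < ∞`). [cite: Tao2011, §2 (x-def) and §1 (7)] -/
def MemSobolevX (k : ℕ) (T : ℝ) (u : ℝ → ℝ³ → ℝ³) : Prop :=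
  (∀ j ≤ k, ∃ C : ℝ≥0, ∀ t ∈ Icc 0 T, ∫⁻ x, ‖iteratedFDeriv ℝ j (u t) x‖ₑ ^ 2 ≤ C) ∧
    (∫⁻ t in Ioo 0 T, ∫⁻ x, ‖iteratedFDeriv ℝ (k + 1) (u t) x‖ₑ ^ 2) < ⊤

/-- The `L^∞_t H^k_x` half of `X^k`: uniform-in-time `L²` bounds on `Dʲ(u t)`, `j ≤ k`. [folklore] -/
theorem MemSobolevX.exists_bound {k : ℕ} {T : ℝ} {u : ℝ → ℝ³ → ℝ³} (h : MemSobolevX k T u)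
    {j : ℕ} (hj : j ≤ k) : ∃ C : ℝ≥0, ∀ t ∈ Icc 0 T, ∫⁻ x, ‖iteratedFDeriv ℝ j (u t) x‖ₑ ^ 2 ≤ C :=
  h.1 j hj

/-- `⋂ₖ X^k ⊇ L^∞_t H^∞_x` on a bounded slab: if all Sobolev norms of `u` are bounded on `[0, T]`
then `u ∈ X^k([0, T] × ℝ³)` for every `k` (the `L²_t` norm of a function bounded by `C` on
`(0, T)` is at most `C · T`). [folklore] -/
theorem HasBoundedSobolevNormsOn.memSobolevX {T : ℝ} {u : ℝ → ℝ³ → ℝ³}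
    (h : HasBoundedSobolevNormsOn (Icc 0 T) u) (k : ℕ) : MemSobolevX k T u := by
  refine ⟨fun j _ => h j, ?_⟩
  obtain ⟨C, hC⟩ := h (k + 1)
  calc ∫⁻ t in Ioo 0 T, ∫⁻ x, ‖iteratedFDeriv ℝ (k + 1) (u t) x‖ₑ ^ 2
      ≤ ∫⁻ _ in Ioo 0 T, (C : ℝ≥0∞) :=
        setLIntegral_mono' measurableSet_Ioo fun t ht => hC t (Ioo_subset_Icc_self ht)
    _ = C * volume (Ioo 0 T) := setLIntegral_const _ _
    _ < ⊤ := ENNReal.mul_lt_top ENNReal.coe_lt_top (by simp)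

/-- The zero field lies in every `X^k([0, T] × ℝ³)`. [folklore] -/
@[simp]
theorem memSobolevX_zero (k : ℕ) (T : ℝ) : MemSobolevX k T (0 : ℝ → ℝ³ → ℝ³) :=
  (hasBoundedSobolevNormsOn_zero (Icc 0 T)).memSobolevX k

/-- **Tao 2011, Cor. 11.1 (Bounded enstrophy)** — printed statement: "Let `(u, p, u₀, f, T)` be
an almost smooth, finite energy solution, such that the initial data `(u₀, f, T)` has finite `H¹`
norm. Then `u ∈ X¹([0, T] × ℝ³)`; in particular, `(u, p, u₀, f, T)` is an `H¹` solution."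
Vendored in the homogeneous case `f = 0` and for viscosity `ν > 0` (Tao normalises `ν = 1`;
footnote 3, p. 4: reduce by the rescaling `v(s, x) = ν⁻¹u(s/ν, x)`, `q = ν⁻²p(s/ν, x)`, which
preserves every class involved and maps `[0, T]` to `[0, νT]`), for classical solutions on the
**closed** slab `[0, T] × ℝ³` (`Fluid.IsClassicalNSSolutionOn (Icc 0 T)`: jointly `C^∞` up to
`t = 0` and `t = T`, a subclass of Tao's *almost smooth* solutions, p. 6), of finite energy in
Tao's sense ((6), p. 3: `‖u‖_{L^∞_t L²_x([0,T] × ℝ³)} < ∞`; the data `(u(0), 0, T)` then have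
finite energy `½‖u(0)‖²_{L²}`), whose datum has finite `H¹` norm (given (6) at `t = 0`, this is
`‖∇u(0)‖_{L²} < ∞`). Conclusion: `u ∈ X¹([0, T] × ℝ³)`, i.e. `MemSobolevX 1 T u`. Printed proof:
choose `R` with the exterior initial enstrophy `‖ω₀‖_{L²(ℝ³ ∖ B(0,R))} ≤ δ` (monotone
convergence), apply the enstrophy localisation Thm. 10.1 in the exterior region, smoothness in
the interior `[0, T] × B(0, R + r + 1)`, glue, use Lemma 8.1 for `u ∈ L^∞_t L² ∩ L²_t H¹`, and
pass from `ω = ∇ × u` to `∇u` by Fourier analysis (`∇ · u = 0`). The closedness of the slab is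
essential (Remark 11.2). [cite: Tao2011, Cor. 11.1] -/
def tao2011_boundedEnstrophy : Prop :=
  ∀ ⦃ν T : ℝ⦄ (_hν : 0 < ν) (_hT : 0 < T) ⦃u : ℝ → ℝ³ → ℝ³⦄ ⦃p : ℝ → ℝ³ → ℝ⦄
    (_hsol : FluidPDE.IsClassicalNSSolutionOn (Icc 0 T) ν 0 u p)
    (_hE : ∃ C : ℝ≥0, ∀ t ∈ Icc 0 T, ∫⁻ x, ‖u t x‖ₑ ^ 2 ≤ C)
    (_h₀ : ∫⁻ x, ‖iteratedFDeriv ℝ 1 (u 0) x‖ₑ ^ 2 < ⊤),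
    MemSobolevX 1 T u

/-- **Tao 2011, Cor. 4.3 + Thm. 5.4 (iv)** (with the note closing the proof of Thm. 5.4) —
printed statements. Cor. 4.3 (*Almost smooth `H¹` solutions are essentially mild*): "Let
`(u, p, u₀, f, T)` be an almost smooth `H¹` solution. Then `(u, p̃, u₀, f, T)` is a mild `H¹`
solution, where `p̃ := -Δ⁻¹∂ᵢ∂ⱼ(uᵢuⱼ) + Δ⁻¹∇ · f`. Furthermore, for almost every `t ∈ [0, T]`,
`p(t)` and `p̃(t)` differ by a constant." Thm. 5.4 (iv) (*Regularity*): "If `(u, p, u₀, f, T)` is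
an `H¹` mild solution, and `(u₀, f, T)` is Schwartz, then `u` and `p` are smooth; in fact, one
has `∂ₜʲu, ∂ₜʲp ∈ L^∞_t H^k([0, T] × ℝ³)` for all `j, k ≥ 0`", and the closing note of its proof:
"these arguments did not require the full power of the hypothesis that `(u₀, f, T)` was
Schwartz; it would have sufficed to have `u₀ ∈ H^k_x(ℝ³)` and `f ∈ C^j_t H^k_x(ℝ³)` for all
`j, k ≥ 0`". Vendored, as for `tao2011_boundedEnstrophy`, with `f = 0`, `ν > 0` (footnote-3
rescaling) and for classical solutions on the closed slab `[0, T] × ℝ³`: if such a solution lies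
in `X¹([0, T] × ℝ³)` (`MemSobolevX 1 T u`; together with the datum this is exactly Tao's *`H¹`
solution*, (7) p. 3) and its datum `u(0)` lies in `H^k_x(ℝ³)` for every `k` (all
`∫ ‖Dⁿu(0)‖² < ∞`), then — Cor. 4.3 replaces `p` by the normalised pressure `p̃` without
changing the velocity `u`, and Thm. 5.4 (iv) with `j = 0` applies to the `H¹` mild solution
`(u, p̃)` — `u ∈ L^∞_t H^k_x([0, T] × ℝ³)` for every `k`, i.e. `HasBoundedSobolevNormsOn (Icc 0 T) u`
(pointwise supremum in `t`, equal to the essential one for the jointly smooth `u`, by Fatou). [cite: Tao2011, Cor. 4.3 + Thm. 5.4 (iv)] -/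
def tao2011_hasBoundedSobolevNormsOn_of_memSobolevX : Prop :=
  ∀ ⦃ν T : ℝ⦄ (_hν : 0 < ν) (_hT : 0 < T) ⦃u : ℝ → ℝ³ → ℝ³⦄ ⦃p : ℝ → ℝ³ → ℝ⦄
    (_hsol : FluidPDE.IsClassicalNSSolutionOn (Icc 0 T) ν 0 u p)
    (_hX : MemSobolevX 1 T u)
    (_h₀ : ∀ n : ℕ, ∫⁻ x, ‖iteratedFDeriv ℝ n (u 0) x‖ₑ ^ 2 < ⊤),
    HasBoundedSobolevNormsOn (Icc 0 T) u

/-- **Schwartz ⇒ `H^∞`** ("the Schwartz property implies `H¹`, which in turn implies finite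
energy", Tao2011, §1, p. 3): a rapidly decreasing field on a finite-dimensional space `E` has
all its derivatives in `L²` (for any additive Haar measure). Proof: the decay bound with weight
`K = dim E + 1` gives `‖Dⁿu₀(x)‖² ≤ C² (1 + ‖x‖)^{-2K}` with `2K > dim E`, and
`∫ (1 + ‖x‖)^{-r} < ∞` for `r > dim E` (Mathlib `finite_integral_one_add_norm`). [cite: Tao2011, §1 p. 3] -/
theorem HasRapidSpatialDecay.lintegral_enorm_iteratedFDeriv_sq_lt_top {E F : Type*}
    [NormedAddCommGroup E] [InnerProductSpace ℝ E] [FiniteDimensional ℝ E] [MeasurableSpace E]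
    [BorelSpace E] [NormedAddCommGroup F] [NormedSpace ℝ F] {μ : Measure E} [μ.IsAddHaarMeasure]
    {u₀ : E → F} (h : HasRapidSpatialDecay u₀) (n : ℕ) :
    ∫⁻ x, ‖iteratedFDeriv ℝ n u₀ x‖ₑ ^ 2 ∂μ < ⊤ := by
  set K : ℕ := Module.finrank ℝ E + 1 with hK
  obtain ⟨C, hC⟩ := h n K
  have hpt : ∀ x : E, ‖iteratedFDeriv ℝ n u₀ x‖ₑ ^ 2 ≤
      ENNReal.ofReal (C ^ 2) * ENNReal.ofReal ((1 + ‖x‖) ^ (-((2 * K : ℕ) : ℝ))) := by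
    intro x
    have hx : 0 < 1 + ‖x‖ := by positivity
    have hCx := hC x
    have h1 : ‖iteratedFDeriv ℝ n u₀ x‖ ≤ C / (1 + ‖x‖) ^ K := by
      rw [le_div_iff₀ (by positivity), mul_comm]
      exact hCx
    have h4 : (1 + ‖x‖) ^ (-((2 * K : ℕ) : ℝ)) = ((1 + ‖x‖) ^ (2 * K))⁻¹ := by
      rw [Real.rpow_neg hx.le, Real.rpow_natCast]
    have h2 : ‖iteratedFDeriv ℝ n u₀ x‖ ^ 2 ≤ C ^ 2 * (1 + ‖x‖) ^ (-((2 * K : ℕ) : ℝ)) := by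
      calc ‖iteratedFDeriv ℝ n u₀ x‖ ^ 2 ≤ (C / (1 + ‖x‖) ^ K) ^ 2 :=
            pow_le_pow_left₀ (norm_nonneg _) h1 2
        _ = C ^ 2 * (1 + ‖x‖) ^ (-((2 * K : ℕ) : ℝ)) := by
            rw [h4, div_pow, ← pow_mul, div_eq_mul_inv, mul_comm K 2]
    rw [← ofReal_norm, ← ENNReal.ofReal_pow (norm_nonneg _), ← ENNReal.ofReal_mul (sq_nonneg _)]
    exact ENNReal.ofReal_le_ofReal h2
  have hr : (Module.finrank ℝ E : ℝ) < ((2 * K : ℕ) : ℝ) := by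
    rw [hK]; push_cast; linarith [(Module.finrank ℝ E).cast_nonneg (α := ℝ)]
  calc ∫⁻ x, ‖iteratedFDeriv ℝ n u₀ x‖ₑ ^ 2 ∂μ
      ≤ ∫⁻ x, ENNReal.ofReal (C ^ 2) * ENNReal.ofReal ((1 + ‖x‖) ^ (-((2 * K : ℕ) : ℝ))) ∂μ :=
        lintegral_mono hpt
    _ = ENNReal.ofReal (C ^ 2) * ∫⁻ x, ENNReal.ofReal ((1 + ‖x‖) ^ (-((2 * K : ℕ) : ℝ))) ∂μ :=
        lintegral_const_mul' _ _ ENNReal.ofReal_ne_top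
    _ < ⊤ := ENNReal.mul_lt_top ENNReal.ofReal_lt_top (finite_integral_one_add_norm hr)

/-- Non-vacuity of the classes above: a time-independent rapidly decreasing field `u(t) = u₀` has
all Sobolev norms bounded on any time set (each `∫ ‖Dⁿu₀‖²` is finite,
`HasRapidSpatialDecay.lintegral_enorm_iteratedFDeriv_sq_lt_top`), hence lies in every
`X^k([0, T] × ℝ³)` (`HasBoundedSobolevNormsOn.memSobolevX`); in particular a Schwartz datum
`u(0)` has finite energy and finite `H¹` norm (Tao2011, §1, p. 3). [folklore] -/
theorem HasRapidSpatialDecay.hasBoundedSobolevNormsOn_const {u₀ : ℝ³ → ℝ³}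
    (h : HasRapidSpatialDecay u₀) (S : Set ℝ) : HasBoundedSobolevNormsOn S fun _ => u₀ :=
  fun n => ⟨(∫⁻ x, ‖iteratedFDeriv ℝ n u₀ x‖ₑ ^ 2).toNNReal, fun _ _ =>
    (ENNReal.coe_toNNReal (h.lintegral_enorm_iteratedFDeriv_sq_lt_top n).ne).ge⟩

/-- A time-independent rapidly decreasing field lies in every `X^k([0, T] × ℝ³)`. [folklore] -/
theorem HasRapidSpatialDecay.memSobolevX_const {u₀ : ℝ³ → ℝ³} (h : HasRapidSpatialDecay u₀)
    (k : ℕ) (T : ℝ) : MemSobolevX k T fun _ => u₀ :=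
  (h.hasBoundedSobolevNormsOn_const _).memSobolevX k

/-- **Assembly (proved): `tao2011_hasBoundedSobolevNormsOn` from its two printed ingredients.**
Given Cor. 11.1 (`tao2011_boundedEnstrophy`) and Cor. 4.3 + Thm. 5.4 (iv)
(`tao2011_hasBoundedSobolevNormsOn_of_memSobolevX`), a finite-energy classical solution on the
closed slab `[0, T] × ℝ³` with `f = 0` and Schwartz datum has all Sobolev norms bounded on
`[0, T]`: the Schwartz datum `u(0)` has every `Dⁿu(0)` in `L²`
(`HasRapidSpatialDecay.lintegral_enorm_iteratedFDeriv_sq_lt_top`), in particular finite `H¹`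
norm, so Cor. 11.1 puts `u` in `X¹([0, T] × ℝ³)`, and then Cor. 4.3 + Thm. 5.4 (iv) give
`u ∈ L^∞_t H^k_x` for all `k` — exactly the chain recorded in the docstring of
`tao2011_hasBoundedSobolevNormsOn`. [cite: Tao2011, Cor. 11.1 + Cor. 4.3 + Thm. 5.4 (iv)] -/
theorem tao2011_hasBoundedSobolevNormsOn_of_parts (hA : tao2011_boundedEnstrophy)
    (hB : tao2011_hasBoundedSobolevNormsOn_of_memSobolevX) :
    tao2011_hasBoundedSobolevNormsOn := by
  intro ν T hν hT u p hsol hE h₀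
  have hHk : ∀ n : ℕ, ∫⁻ x, ‖iteratedFDeriv ℝ n (u 0) x‖ₑ ^ 2 < ⊤ :=
    h₀.lintegral_enorm_iteratedFDeriv_sq_lt_top
  exact hB hν hT hsol (hA hν hT hsol hE (hHk 1)) hHk


end Literature.Analysis.FluidPDE

end
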